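import Literature.NumberTheory.LFunctions.WeilExplicitDirichlet
import Literature.NumberTheory.LFunctions.WeilExplicitProofs
import HarnessLib

/-!
# Weil 1952 (11) with characters in WEIL'S PRINTED FORM (kernel `K_{1,f}`, finite part `PF`), and the
# reality of the twisted quadratic functional

Extension of `WeilExplicitDirichlet.lean` (the base file: `charParity`, `weilPrimeTermChar`,
`weilArchTermChar`, `weilFunctionalChar`, `HasWeilZeroSideChar`, `weilQuadraticChar`, …, which types
Weil's (11) for `k = ℚ` in DIGAMMA form).  Here:

1. **Weil's own right-hand side of (11)**, symbol by symbol for `k = ℚ` (A. Weil, *Sur les «formules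
   explicites» de la théorie des nombres premiers*, Lund 1952, pp. 260–262): the kernel
   `K_{1,f}(x) = e^{(1/2 − f)|x|}/|eˣ − e^{−x}|` (p. 262), the finite part
   `PF ∫ α(x) dx = lim_{λ→+∞} [∫ (1 − e^{−λ|x|}) α(x) dx − 2β(0) log λ]`, `β(x) = |x|α(x)` (p. 260),
   and `δ_χ ∫F(e^{x/2} + e^{−x/2}) + F(0) log A − Σ_𝔭Σ_n (…) − PF ∫ F(x) K_{1,f}(x) dx` with `A = q/2π`,
   `f = a_χ` (`weilExplicitRHSWeil`); the statement (11) on Weil's class (A), (B) with this right-hand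
   side is the named fact `Weil1952_eq11_dirichlet`, and the DICTIONARY with the digamma form of the
   base file is the named fact `weilExplicitRHSWeil_eq_weilFunctionalChar`:
   `−PF ∫ g K_{1,a} = (1/2π) ∫ ĝ(1/2 + it) Re ψ(1/4 + a/2 + it/2) dt + g(0) log 2` — Weil p. 260–261
   (the Fourier transform of `Re Γ′/Γ(1/2 + it)` is the distribution `−π PF(|e^{x/2} − e^{−x/2}|^{−1})`,
   «en vertu de formules connues», then (5), (10): `d log 𝒢_{1,a}(1/2+it)/ds = log 2 + Re ψ(1/4+a/2+it/2)`).
   For `q = 1`, `a = 0` the dictionary is exactly the consistency of (11) with the tree's PROVED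
   `explicit_formula_holds`. (The cell re-checked the constant `log 2` numerically for `a = 0, 1`; that is
   evidence, not the justification of the fact, which is cited as printed.)
2. (The `C_c^∞` form of Weil's lemma, `χ.RiemannHypothesis ↔ WeilPositivityChar χ`, is NOT restated
   here: its `→` half is the base file's `WeilPositivityChar.of_riemannHypothesis` modulo
   `explicit_formula_dirichlet`, and the deep `←` half is being PROVED in the cell's
   `WeilCriterionConverseDirichlet.lean`.)
3. PROVED: `χ(−1) = (−1)^{a_χ}`; **reality**: `conj W_χ(k) = W_χ(k)` for self-adjoint `k`
   (`conj k(−t) = k(t)`) and `Im Q_χ(g) = 0` for every `g` (hypothesis-free, as `weilQuadratic_im_holds`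
   on the `ζ`-side); hence the «il faut» half of the printed lemma on `C_c^∞` modulo the explicit
   formula, `Weil1952_criterion_dirichlet_mp_of_isWeilTest`.

References: Weil 1952 [Weil1952FormulesExplicites] pp. 253–262; E. Bombieri, Rend. Lincei (9) 11 (2000)
§§2–3 (reality of the hermitian form, `ζ` case) [Bombieri2000Weil].
-/

noncomputable section

open Complex Filter Set MeasureTheory
open scoped Real Topology ComplexConjugate ComplexOrder ArithmeticFunction.vonMangoldt

namespace Literature.NumberTheory.LFunctions

variable {q : ℕ}

/-! ## Weil's kernel and finite part -/

/-- Weil's archimedean kernel at a real place: `K_{1,f}(x) = e^{(1/2 − f)|x|} / |eˣ − e^{−x}|`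
(`f ∈ {0, 1}` the parity). [cite: Weil1952FormulesExplicites, p. 262 (definition of K_{1,f})] -/
def weilKernelK1 (f : ℕ) (x : ℝ) : ℝ :=
  Real.exp ((1 / 2 - f) * |x|) / |Real.exp x - Real.exp (-x)|

/-- Weil's finite part of `∫ F(x) K_{1,f}(x) dx` (p. 260):
`PF ∫ α = lim_{λ→+∞} [∫ (1 − e^{−λ|x|}) α(x) dx − 2β(0) log λ]` with `α = F·K_{1,f}`, `β = |x|α`, so
that `2β(0) = F(0)` (`|eˣ − e^{−x}| ∼ 2|x|` at `0`).  A `limUnder` (junk if the limit fails to exist;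
it exists for `F` in Weil's class, pp. 260–261). [cite: Weil1952FormulesExplicites, p. 260 (definition of PF) and p. 262] -/
def weilPFIntegralK1 (f : ℕ) (F : ℝ → ℂ) : ℂ :=
  limUnder atTop fun lam : ℝ ↦
    (∫ x : ℝ, ((1 - Real.exp (-lam * |x|) : ℝ) : ℂ) * (F x * (weilKernelK1 f x : ℂ))) -
      F 0 * (Real.log lam : ℂ)

/-- **The right-hand side of Weil's (11) AS PRINTED, for `k = ℚ`** and a Dirichlet character `χ`
mod `q` of parity `a = a_χ` (one real place: `η = 1`, `f = a`, `φ = 0`; `A = q/2π`):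
`δ_χ ∫ F(x)(e^{x/2} + e^{−x/2}) dx + F(0) log(q/2π)
  − Σ_n Λ(n) n^{−1/2} [χ(n) F(log n) + conj χ(n) F(−log n)] − PF ∫ F(x) K_{1,a}(x) dx`,
with `δ_χ ∫F(e^{x/2}+e^{−x/2}) = Φ(0) + Φ(1) = weilPolarTerm F` present iff `q = 1` (as in the base
file's `weilFunctionalChar`).  Equal to `weilFunctionalChar χ F` on test functions
(`weilExplicitRHSWeil_eq_weilFunctionalChar`). [cite: Weil1952FormulesExplicites, (11) pp. 261–262, k = ℚ] -/
def weilExplicitRHSWeil (χ : DirichletCharacter ℂ q) (F : ℝ → ℂ) : ℂ :=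
  (if q = 1 then weilPolarTerm F else 0) + F 0 * (Real.log (q / (2 * π)) : ℂ) -
    weilPrimeTermChar χ F - weilPFIntegralK1 (charParity χ) F

/-! ## Named facts -/

/-- **Weil 1952, eq. (11), for `k = ℚ` and a primitive Dirichlet character `χ` mod `q ≠ 1`, AS PRINTED**
(Weil's class (A), (B) = `IsWeil1952Test`; Weil's `PF` form of the archimedean term): «la somme
`Σ Φ(ω)` … tend vers une limite pour `T → +∞`, et cette limite a la valeur» `weilExplicitRHSWeil χ F`.
(Truncation `|Im ρ| ≤ T` vs `< T`: same limit.)  The `C_c^∞`/digamma form is the base file's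
`explicit_formula_dirichlet`. [cite: Weil1952FormulesExplicites, (11) pp. 261–262, k = ℚ] -/
def Weil1952_eq11_dirichlet : Prop :=
  ∀ {q : ℕ} [NeZero q] (χ : DirichletCharacter ℂ q), q ≠ 1 → χ.IsPrimitive →
    ∀ {F : ℝ → ℂ}, IsWeil1952Test F → HasWeilZeroSideChar χ F (weilExplicitRHSWeil χ F)

/-- **Dictionary: Weil's printed archimedean term = the digamma form** on test functions:
`weilExplicitRHSWeil χ g = weilFunctionalChar χ g` for `g ∈ C_c^∞`, i.e. for `a ∈ {0, 1}`
`−PF ∫ g(x) K_{1,a}(x) dx = (1/2π) ∫ ĝ(1/2 + it) Re ψ(1/4 + a/2 + it/2) dt + g(0) log 2`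
(Weil pp. 260–261: `lim ∫_{−T}^{T} Ψ(t) Re Γ′/Γ(1/2 + it) dt = −π PF ∫ F₁(x) dx/|e^{x/2} − e^{−x/2}|`,
with (5), (10) p. 254/258).  Stated for every `χ` (it is an identity between right-hand sides).
[cite: Weil1952FormulesExplicites, pp. 260–261 (Fourier transform of Re Γ′/Γ = −π PF) with (5), (10), (11)] -/
def weilExplicitRHSWeil_eq_weilFunctionalChar : Prop :=
  ∀ {q : ℕ} (χ : DirichletCharacter ℂ q) {g : ℝ → ℂ}, IsWeilTest g →
    weilExplicitRHSWeil χ g = weilFunctionalChar χ g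

/-! ## Proved: parity sign, reality of the hermitian form, the «il faut» half on `C_c^∞` -/

section API

variable (χ : DirichletCharacter ℂ q)

/-- `χ(−1) = (−1)^a`, `a = charParity χ` (Weil's (1) at the real place: `χ_∞(x) = (x/|x|)^{−f}`).
[cite: Weil1952FormulesExplicites, (1) p. 253] -/
theorem eval_neg_one_eq_pow_charParity [NeZero q] : χ (-1) = (-1) ^ charParity χ := by
  rcases χ.even_or_odd with h | h
  · rw [charParity_of_even h, pow_zero]; exact h
  · rw [charParity_of_odd h, pow_one]; exact h

/-- For a self-adjoint `k` (`conj k(−t) = k(t)`) every term of `W_χ(k)` is self-conjugate, hence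
`conj W_χ(k) = W_χ(k)`: the prime summand is `Λ(n)n^{−1/2}(χ(n)k(log n) + conj(χ(n)k(log n)))`, the
archimedean integrand `k̂(1/2 + it) Re ψ(…)` has `k̂` real on the critical line
(`conj_weilMellin_of_selfAdjoint`), `k(0)` is real, and so is the polar term (modulus `1`).  Same
bookkeeping as `conj_weilFunctional_of_selfAdjoint` (Bombieri 2000 §§2–3).
[cite: Bombieri2000Weil, §§2–3 (the form is hermitian); Weil1952FormulesExplicites, the «lemme» p. 262] -/
theorem conj_weilFunctionalChar_of_selfAdjoint {k : ℝ → ℂ} (hk : ∀ t, conj (k (-t)) = k t) :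
    conj (weilFunctionalChar χ k) = weilFunctionalChar χ k := by
  have hM := conj_weilMellin_of_selfAdjoint hk
  have hk' : ∀ t, conj (k t) = k (-t) := fun t ↦ by simpa using hk (-t)
  have h0 : conj (k 0) = k 0 := by simpa using hk 0
  have hP : conj (weilPolarTerm k) = weilPolarTerm k := by
    rw [weilPolarTerm, map_add, hM, hM, map_zero, map_one, sub_zero, sub_self, add_comm]
  have hΛ : conj (weilPrimeTermChar χ k) = weilPrimeTermChar χ k := by
    rw [weilPrimeTermChar, Complex.conj_tsum]
    refine tsum_congr fun n ↦ ?_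
    rw [map_mul, map_div₀, Complex.conj_ofReal, Complex.conj_ofReal, map_add, map_mul, map_mul,
      Complex.conj_conj, hk', hk', neg_neg]
    ring
  have hA : conj (weilArchTermChar q (charParity χ) k) = weilArchTermChar q (charParity χ) k := by
    rw [weilArchTermChar, map_add, map_mul, map_mul, h0, Complex.conj_ofReal, weilArchIntegralChar,
      ← integral_conj]
    congr 2
    · rw [map_div₀, map_one, map_mul, map_ofNat, Complex.conj_ofReal]
    · refine integral_congr_ae (Eventually.of_forall fun t ↦ ?_)
      dsimp only
      rw [map_mul, Complex.conj_ofReal, hM]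
      congr 2
      rw [map_add, map_mul, Complex.conj_ofReal, Complex.conj_I, map_div₀, map_one, map_ofNat]
      ring
  rw [weilFunctionalChar, map_add, map_sub, hΛ, hA]
  congr 2
  split_ifs
  · exact hP
  · exact map_zero _

/-- **The twisted quadratic functional is real**: `Im W_χ(g ⋆ g̃) = 0` for every `g : ℝ → ℂ`
(`g ⋆ g̃` is self-adjoint, `conj_weilConv_weilReflect_neg`; no smoothness needed).
[cite: Bombieri2000Weil, §2 (hermitian form); Weil1952FormulesExplicites, the «lemme» p. 262] -/
theorem weilQuadraticChar_im (g : ℝ → ℂ) : (weilQuadraticChar χ g).im = 0 :=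
  Complex.conj_eq_iff_im.1
    (conj_weilFunctionalChar_of_selfAdjoint χ (conj_weilConv_weilReflect_neg g))

/-- Hence `Q_χ(g)` is the real number `Re Q_χ(g)`. [cite: Bombieri2000Weil, §2 (hermitian form)] -/
theorem weilQuadraticChar_eq_re (g : ℝ → ℂ) : weilQuadraticChar χ g = ((weilQuadraticChar χ g).re : ℂ) :=
  Complex.ext rfl (by rw [Complex.ofReal_im, weilQuadraticChar_im])

/-- The «il faut» half of the PRINTED lemma on the `C_c^∞` sub-class, modulo the explicit formula:
under RH for `L(s, χ)` (`χ` primitive, `q ≠ 1`) the zero-side value of `g ⋆ g̃` exists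
(`= Q_χ(g)`, by `explicit_formula_dirichlet`) and is `≥ 0` in `ComplexOrder` (real by
`weilQuadraticChar_im`, non-negative by `WeilPositivityChar.of_riemannHypothesis`).  Compare
`Weil1952_criterion_zeta_mp_of_isWeilTest`. [cite: Weil1952FormulesExplicites, the «lemme» p. 262 («il faut»)] -/
theorem Weil1952_criterion_dirichlet_mp_of_isWeilTest [NeZero q] (hEF : explicit_formula_dirichlet)
    (hq : q ≠ 1) (hχ : χ.IsPrimitive) (hRH : χ.RiemannHypothesis) {g : ℝ → ℂ} (hg : IsWeilTest g) :
    ∃ Z : ℂ, HasWeilZeroSideChar χ (weilConv g (weilReflect g)) Z ∧ 0 ≤ Z := by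
  refine ⟨weilQuadraticChar χ g, hEF χ hq hχ (hg.weilConv hg.weilReflect), ?_⟩
  rw [Complex.nonneg_iff]
  exact ⟨WeilPositivityChar.of_riemannHypothesis hEF hq hχ hRH g hg, (weilQuadraticChar_im χ g).symm⟩

end API

/-! ## Guarded restatement of the dictionary (the unguarded name above admits `q = 0`) -/

/-- **Dictionary, GUARDED form** (`q ≠ 0`): for `χ` mod `q` with `[NeZero q]` and `g ∈ C_c^∞`,
`weilExplicitRHSWeil χ g = weilFunctionalChar χ g`, i.e. for `a ∈ {0,1}`
`−PF ∫ g K_{1,a} = (1/2π) ∫ ĝ(1/2+it) Re ψ(1/4 + a/2 + it/2) dt + g(0) log 2` (Weil pp. 260–261).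
This is the statement to thread as a hypothesis.  The UNGUARDED `weilExplicitRHSWeil_eq_weilFunctionalChar`
above also quantifies over `q = 0` (`DirichletCharacter ℂ 0`, `ZMod 0 = ℤ`), where Lean's junk value
`Real.log 0 = 0` makes the two sides differ by `g(0) log 2π` — it is FALSE as stated (refutation by
weil-grh-5, `WeilExplicitDirichletWeilFormModZero.lean`: compare `(q, χ) = (1, 1)` and `(0, 1)` on a bump)
and is kept only because landed definitions are not edited in place; do not use it.
[cite: Weil1952FormulesExplicites, pp. 260–261 (Fourier transform of Re Γ′/Γ = −π PF) with (5), (10), (11)] -/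
def weilExplicitRHSWeil_eq_weilFunctionalChar_of_neZero : Prop :=
  ∀ {q : ℕ} [NeZero q] (χ : DirichletCharacter ℂ q) {g : ℝ → ℂ}, IsWeilTest g →
    weilExplicitRHSWeil χ g = weilFunctionalChar χ g

/-- The unguarded statement implies the guarded one (bookkeeping; the converse is the point).
[cite: Weil1952FormulesExplicites, pp. 260–261] -/
theorem weilExplicitRHSWeil_eq_weilFunctionalChar_of_neZero_of
    (h : weilExplicitRHSWeil_eq_weilFunctionalChar) :
    weilExplicitRHSWeil_eq_weilFunctionalChar_of_neZero :=
  fun χ _ hg ↦ h χ hg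

end Literature.NumberTheory.LFunctions

end
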